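import Summits.MatrixMultiplication.MatrixMultiplication.Theorems.SoloInformedLinesToBox
import Summits.MatrixMultiplication.MatrixMultiplication.Theorems.SoloInformedDirtyCols
import Summits.MatrixMultiplication.MatrixMultiplication.Theorems.SoloInformedStepThreeSpread

/-!
# THEOREM 8.20, Step 3 composed: the all-`𝓛` world ends the poor world numerically

This work, §8.8 (T13) and C3-m2 §5.3 Step 3, §5.6 (B), §5.7 (gen 108: the kernel glue). Setting as in
`SoloInformedBoxEnding` (every chart).

Input of Step 3: a heavy family `J_p` (`n ≤ 2|J_p|`) whose columns of `a` all follow one row pattern `α_i` off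
`≤ t` rows each (`Ec j`). Output (`Data.allL_ending`): `n·t·(|J_p| − 4t) ≤ M`, or `n²·t ≤ 2M`, or `n³ ≤ 1536·M`.
The chain: light rows by double counting (`heavy_card_mul_le`, at least half) → the light rows are two-classed
(`Data.light_rows_two_classed`, Step 3.2) → the popular class `α` on `I₁` (`n ≤ 4|I₁|`) → the column split
(`Data.col_split`): `K_c` heavy ends by (T2b) (`Data.card_mul_le_of_c_rowsOn₂`); else `K_b` heavy, with base rows
and column classes `β_k`; clean columns heavy end by (T2a) (`Data.card_mul_le_of_b_rowsOn₂`); else the dirty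
columns are heavy and `Data.dirty_cols_grouped` bounds or produces one class `β` on a half `K_g`, and
`Data.cols_ending` (THEOREM 8.19 in every class configuration — in particular no case distinction on `α = 0`,
`β = 0`, `α ∼ β` is needed) ends with `c_I = 4`, `c_J = 2`, `c_K = 8`, `d = 4t`, budget `4608·(20t+1) ≤ n`.
-/

namespace Summit.MatrixMultiplication.MatrixMultiplication.Theorems.TwistedTPP

namespace FibreLines

variable {ι G : Type*} [AddCommGroup G]
variable {G₀ : Type*} [AddCommGroup G₀] {R : Type*}

/-- **THEOREM 8.20, Step 3 (numerical form, every chart).** [this work §8.8 (T13); C3-m2 §5.3, §5.6 (B), §5.7] -/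
theorem Data.allL_ending [Fintype ι] [DecidableEq ι] [Fintype G₀] [DecidableEq G₀] [Fintype R]
    [DecidableEq R] [DecidableEq G] (hG : ∀ x : G, x = -x → x = 0) (D : Data ι G) (Φ : Chart ι G₀)
    (κ : G → R) (hκ : ∀ x y, κ x = κ y → SignEq x y) (hsep : D.SepAll Φ) (Jp : Finset ι) (αc : ι → G)
    (t : ℕ) (Ec : ι → Finset ι) (hEc : ∀ j ∈ Jp, (Ec j).card ≤ t ∧ ∀ i, i ∉ Ec j → SignEq (D.a i j) (αc i))
    (hJp : Fintype.card ι ≤ 2 * Jp.card) (hbudget : 4608 * (20 * t + 1) ≤ Fintype.card ι) :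
    Fintype.card ι * t * (Jp.card - 4 * t) ≤ Fintype.card R * Fintype.card G₀ ∨
    Fintype.card ι ^ 2 * t ≤ 2 * (Fintype.card R * Fintype.card G₀) ∨
    Fintype.card ι ^ 3 ≤ 1536 * (Fintype.card R * Fintype.card G₀) := by
  classical
  set n := Fintype.card ι with hn
  set M := Fintype.card R * Fintype.card G₀ with hM
  -- the light rows (at least half of all rows) and their exception sets
  set Il : Finset ι := Finset.univ.filter fun i => (Jp.filter fun j => i ∈ Ec j).card ≤ 2 * t with hIl
  have hsplit : Il.card + (Finset.univ.filter fun i => ¬ (Jp.filter fun j => i ∈ Ec j).card ≤ 2 * t).card = n := by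
    rw [hn, ← Finset.card_univ]; exact Finset.card_filter_add_card_filter_not _
  have hIln : n ≤ 2 * Il.card := by
    have h := BoxArith.heavy_half _ _ n Jp.card n 1 t (2 * t)
      (heavy_card_mul_le Jp Finset.univ Ec t (2 * t) fun j hj => (hEc j hj).1) (by omega)
      (Finset.card_le_univ _) (by omega) hsplit
    omega
  set Ea : ι → Finset ι := fun i => Jp.filter fun j => i ∈ Ec j with hEadef
  have hEa : ∀ i ∈ Il, (Ea i).card ≤ 2 * t ∧ ∀ j ∈ Jp, j ∉ Ea i → SignEq (D.a i j) (αc i) :=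
    fun i hi => ⟨(Finset.mem_filter.1 hi).2, fun j hj hjE =>
      (hEc j hj).2 i fun h => hjE (Finset.mem_filter.2 ⟨hj, h⟩)⟩
  -- Step 3.2: the light rows are two-classed
  rcases D.light_rows_two_classed hG Φ κ hκ hsep Il Jp αc Ea (2 * t) t hEa (by omega) with hb | ⟨γ, γ', hγ⟩
  · left
    have e : Jp.card - 2 * (2 * t) = Jp.card - 4 * t := by omega
    rw [e] at hb
    exact hb
  right
  -- the popular class
  obtain ⟨I₁, hI₁, hI₁n, α, hα⟩ : ∃ I₁ ⊆ Il, n ≤ 4 * I₁.card ∧ ∃ α : G, ∀ i ∈ I₁, SignEq (αc i) α := by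
    have hAB : (Il.filter fun i => SignEq (αc i) γ).card +
        (Il.filter fun i => ¬ SignEq (αc i) γ).card = Il.card := Finset.card_filter_add_card_filter_not _
    by_cases hA : n ≤ 4 * (Il.filter fun i => SignEq (αc i) γ).card
    · exact ⟨Il.filter fun i => SignEq (αc i) γ, Finset.filter_subset _ _, hA, γ,
        fun i hi => (Finset.mem_filter.1 hi).2⟩
    · refine ⟨Il.filter fun i => ¬ SignEq (αc i) γ, Finset.filter_subset _ _, by omega, γ',
        fun i hi => ?_⟩
      obtain ⟨hiI, hiγ⟩ := Finset.mem_filter.1 hi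
      exact (hγ i hiI).resolve_left hiγ
  have hEa₂ : ∀ i ∈ I₁, (Ea i).card ≤ 2 * t ∧ ∀ j ∈ Jp, j ∉ Ea i → SignEq (D.a i j) α :=
    fun i hi => ⟨(hEa i (hI₁ hi)).1, fun j hj hjE => ((hEa i (hI₁ hi)).2 j hj hjE).trans (hα i hi)⟩
  have hEa₁ : ∀ i ∈ I₁, (Ea i).card ≤ 4 * t ∧ ∀ j ∈ Jp, j ∉ Ea i → SignEq (D.a i j) α :=
    fun i hi => ⟨(hEa₂ i hi).1.trans (by omega), (hEa₂ i hi).2⟩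
  have hEc₁ : ∀ j ∈ Jp, (Ec j).card ≤ 4 * t ∧ ∀ i ∈ I₁, i ∉ Ec j → SignEq (D.a i j) α :=
    fun j hj => ⟨(hEc j hj).1.trans (by omega), fun i hi hiE => ((hEc j hj).2 i hiE).trans (hα i hi)⟩
  -- Step 3.1: the column split
  set Kc : Finset ι := Finset.univ.filter fun k => ∀ i ∈ I₁, ∀ i' ∈ I₁, SignEq (D.c k i) (D.c k i')
    with hKcdef
  set Kb : Finset ι := Finset.univ.filter fun k => ¬ ∀ i ∈ I₁, ∀ i' ∈ I₁, SignEq (D.c k i) (D.c k i')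
    with hKbdef
  have hKcb : Kc.card + Kb.card = n := by
    rw [hn, ← Finset.card_univ]; exact Finset.card_filter_add_card_filter_not _
  by_cases hKc : n ≤ 2 * Kc.card
  · -- `K_c` heavy: (T2b)
    right
    have hb := D.card_mul_le_of_c_rowsOn₂ Φ κ hκ hsep I₁ Kc fun k hk => (Finset.mem_filter.1 hk).2
    calc n ^ 3 = n * n * n := by ring
      _ ≤ n * (2 * Kc.card) * (4 * I₁.card) := Nat.mul_le_mul (Nat.mul_le_mul_left _ hKc) hI₁n
      _ = 8 * (n * Kc.card * I₁.card) := by ring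
      _ ≤ 8 * M := Nat.mul_le_mul_left _ hb
      _ ≤ 1536 * M := by omega
  have hKb : n ≤ 2 * Kb.card := by omega
  have hKbE : ∀ k ∈ Kb, ∃ E : Finset ι, E.card ≤ 2 * (2 * t) ∧
      ∀ j ∈ Jp, j ∉ E → ∀ j' ∈ Jp, j' ∉ E → SignEq (D.b j' k) (D.b j k) := fun k hk =>
    (D.col_split hG I₁ Jp (2 * t) Ea hEa₂ k).resolve_left (Finset.mem_filter.1 hk).2
  choose! Eb hEbc hEbb using hKbE
  -- base rows and the column classes `β_k`
  have hbase : ∀ k ∈ Kb, ∃ j ∈ Jp, j ∉ Eb k := fun k hk =>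
    Finset.exists_mem_notMem_of_card_lt_card (s := Eb k) (t := Jp) (by have := hEbc k hk; omega)
  choose! jb hjbJ hjbE using hbase
  set βc : ι → G := fun k => D.b (jb k) k with hβc
  have hEb : ∀ k ∈ Kb, (Eb k).card ≤ 4 * t ∧ ∀ j ∈ Jp, j ∉ Eb k → SignEq (D.b j k) (βc k) :=
    fun k hk => ⟨by have := hEbc k hk; omega,
      fun j hj hjE => hEbb k hk (jb k) (hjbJ k hk) (hjbE k hk) j hj hjE⟩
  -- clean and dirty columns
  set Kcl : Finset ι := Kb.filter fun k => ∀ j ∈ Jp, SignEq (D.b j k) (βc k) with hKcldef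
  set Kd : Finset ι := Kb.filter fun k => ¬ ∀ j ∈ Jp, SignEq (D.b j k) (βc k) with hKddef
  have hKcd : Kcl.card + Kd.card = Kb.card := Finset.card_filter_add_card_filter_not _
  by_cases hKcl : n ≤ 4 * Kcl.card
  · -- clean columns heavy: the rows `J_p` of `b` agree there, (T2a)
    right
    have hb := D.card_mul_le_of_b_rowsOn₂ Φ κ hκ hsep Jp Kcl fun j hj j' hj' k hk =>
      ((Finset.mem_filter.1 hk).2 j' hj').trans ((Finset.mem_filter.1 hk).2 j hj).symm
    calc n ^ 3 = n * n * n := by ring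
      _ ≤ n * (4 * Kcl.card) * (2 * Jp.card) := Nat.mul_le_mul (Nat.mul_le_mul_left _ hKcl) hJp
      _ = 8 * (n * Kcl.card * Jp.card) := by ring
      _ ≤ 8 * M := Nat.mul_le_mul_left _ hb
      _ ≤ 1536 * M := by omega
  have hKd : n ≤ 4 * Kd.card := by omega
  have hKdb : ∀ k ∈ Kd, k ∈ Kb := fun k hk => (Finset.mem_filter.1 hk).1
  have hdev : ∀ k ∈ Kd, ∃ j ∈ Jp, ¬ SignEq (D.b j k) (βc k) := by
    intro k hk
    have h := (Finset.mem_filter.1 hk).2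
    push Not at h
    exact h
  choose! jd hjdJ hjdne using hdev
  -- the dirty columns: bound, or one class `β` on a half `K_g`, then THEOREM 8.19 (every class configuration)
  rcases D.dirty_cols_grouped hG Φ κ hκ hsep I₁ Jp Kd (4 * t) t Ea Ec Eb βc jd hEa₁ hEc₁
      (fun k hk => hEb k (hKdb k hk)) (fun k hk => ⟨hjdJ k hk, fun h => hjdne k hk h.symm⟩)
      (by omega) with hb | ⟨Kg, hKg, hKdg, β, hβ⟩
  · left
    have hmin : min (I₁.card - 2 * (4 * t)) t = t := min_eq_right (by omega)
    rw [hmin] at hb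
    exact hb
  · right
    have hK : n ≤ 8 * Kg.card := by omega
    have h := D.cols_ending hG Φ κ hκ hsep I₁ Jp Kg (4 * t) 4 2 8 Ea Ec Eb hEa₁ hEc₁
      (fun k hk => ⟨(hEb k (hKdb k (hKg hk))).1, fun j hj hjE => hβ k hk j hj hjE⟩) hI₁n hJp hK
      (by
        calc 36 * (4 * (2 * 2) * 8) * ((2 * 2 + 1) * (4 * t) + 1) = 4608 * (20 * t + 1) := by ring
          _ ≤ n := hbudget)
    calc n ^ 3 ≤ 12 * (4 * (2 * 2) * 8) * M := h
      _ = 1536 * M := by ring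

end FibreLines

end Summit.MatrixMultiplication.MatrixMultiplication.Theorems.TwistedTPP
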